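import Summits.QuantumFields.BalabanUV.T4Continuum.Support.NE9FutureProfileEnd
import Summits.QuantumFields.BalabanUV.T4Continuum.Support.NE9ChannelReadingOfRecord
import Summits.QuantumFields.BalabanUV.T4Continuum.Support.NE9TableReading
import Literature.MathematicalPhysics.QuantumFieldTheory.Balaban1983to89.T4HistoryLipschitzOuter
import Summits.QuantumFields.BalabanUV.T4Continuum.Support.NE9MarginalProjection

/-!
# NE9FutureProfileRecordPrelim — bookkeeping for ROUTE R4's END OF RECORD (part 1 of 2): truncations ∕ weighted readings ∕
# embeddings, the generic «orbit stays in the inner ball» lemma for K2♭'s `emb`, the record's injection `JRec := injRead RdAmb`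
# (‖·‖ ≤ √2·τ̄), and the weighted table bounds of channel outputs (INTERFACE REQUEST NE9 (R4-4), owner)

Cell `pub-balaban`, T4-DAG §6 NE9; BINDER row NE9 OWNER lineage `b2b-balaban-t4-ne9-p1` gen 60, CRUX PROVER NE9 (ruling e34b3e0c (2));
route R4 «fading by Earle–Hamilton» (`t4/ROUTES-NE9.md` v4 §L1.0).  Letters: `Pot := lp (ι → ℂ) ∞` (`NE9TableReading`), `𝔜 := lp (Bg ×
C.Dom → ℂ) ∞` (ambient slice space, `NE9SliceSpaceOfRecord`), `RdAmb` (`NE9ChannelReadingOfRecord` §6), K2♭ `NE9FutureProfileStep∕End`.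
HONEST FRAMING (T4-DAG PAGE 1).  Rung (B)+1 of the FINITE-VOLUME T⁴ programme — NOT infinite volume, NOT a mass gap, NOT Clay.  NE9
(`T4OutputRate.NE9` ∧ `FadingMemory`) is a cell NEW ESTIMATE, NOT PRINTED in [I] = [Balaban1987RG1] (CMP **109**), [II] =
[Balaban1988RG2Cluster] (CMP **116**), NOT PROVED for Bałaban's E^{(j)} («NE9 ⇐ the named binders»; WALLED ON A MODEL O-NE9-1; spine 0∕9).
HONEST DEPENDENCY (cell line, verbatim): continuum YM on T⁴ ⇐ BetaPertH ∧ nine spine estimates (0/9 proved); BetaPertH ⇐ (D1) ∧ (D4) ∧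
CAP+tail; G-an2-4 gates asym, D1 and NE2/3/4.  `FlowStep.BetaPertH`, (B), (B^μ) do not occur; [I]∕[II] for TYPES only (ABSOLUTE RULE).
CONTENT ([folklore]; one data def `JRec`, 0 sorry): §1 `truncScale_succ_eq`, `truncScale_zero_eq_zero`, `reading_add_of_bound`,
`reading_zero_of_pos`, `embR_zero`, `eq_embR_of_coord` (a slice-space element with REAL weighted coordinates `e^{κd}·H` IS `embR κ H` and
`H` inherits the size `‖G‖`), `norm_emb_le`; §2 `τ_nonneg`∕`τ_geom`, **`JRec`**, `norm_JRec_le`, `abs_channel_trunc_le`,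
`abs_channel_restrict_le`, `eq_reading_of_apply` (idempotence of `restrictScale` is `NE9MarginalProjection.restrictScale_restrictScale_self`).  DISGUISE TEST: bookkeeping only; nothing of Bałaban's.
References (TYPES only): [Balaban1987RG1] CMP **109** (0.23) p. 256, (1.18) p. 263; [Balaban1988RG2Cluster] CMP **116** (1.33)∕(1.36) p. 9.
-/

noncomputable section

namespace Summit.QuantumFields.BalabanUV.T4Continuum.NE9FutureProfileRecordPrelim

open Metric Set
open scoped BigOperators ENNReal
open Literature.MathematicalPhysics.QuantumFieldTheory.Balaban1983to89
open Literature.MathematicalPhysics.QuantumFieldTheory.Balaban1983to89.T4OutputRate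
open Literature.MathematicalPhysics.QuantumFieldTheory.Balaban1983to89.T4HistoryLipschitzRecursion
open Literature.MathematicalPhysics.QuantumFieldTheory.Balaban1983to89.T4HistoryLipschitzOuter
open Summit.QuantumFields.BalabanUV.T4Continuum.NE9EarleHamiltonChain
open Summit.QuantumFields.BalabanUV.T4Continuum.NE9FutureProfileStep
open Summit.QuantumFields.BalabanUV.T4Continuum.NE9FutureProfileEnd
open Summit.QuantumFields.BalabanUV.T4Continuum.NE9ChannelRealLinear
open Summit.QuantumFields.BalabanUV.T4Continuum.NE9SliceSpaceOfRecord
open Summit.QuantumFields.BalabanUV.T4Continuum.NE9ChannelReadingOfRecord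
open Summit.QuantumFields.BalabanUV.T4Continuum.NE9TableReading

variable {C : Carriers} {Bg ι : Type}

/-! ## §1 Bookkeeping: truncations, weighted readings, embeddings -/

/-- [folklore] `truncScale (k+1) H = truncScale k H + H↾(k+1)` (pointwise). -/
theorem truncScale_succ_eq (k : ℕ) (H : Bg → C.Dom → ℝ) :
    truncScale (k + 1) H = truncScale k H + restrictScale (k + 1) H := by
  funext U X
  simp only [truncScale, restrictScale, Pi.add_apply]
  by_cases h1 : C.scale X ≤ k
  · rw [if_pos h1, if_pos (by omega), if_neg (by omega), add_zero]
  · by_cases h2 : C.scale X = k + 1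
    · rw [if_pos (by omega), if_neg h1, if_pos h2, zero_add]
    · rw [if_neg (by omega), if_neg h1, if_neg h2, add_zero]

/-- [folklore] A family vanishing at creation step 0 has `truncScale 0 H = 0`. -/
theorem truncScale_zero_eq_zero {H : Bg → C.Dom → ℝ} (h : ∀ (U : Bg) (X : C.Dom), C.scale X = 0 → H U X = 0) :
    truncScale 0 H = 0 := by
  funext U X
  simp only [truncScale, Pi.zero_apply]
  by_cases hX : C.scale X ≤ 0
  · rw [if_pos hX, h U X (Nat.le_zero.mp hX)]
  · rw [if_neg hX]

/-- [folklore] The weighted reading is ADDITIVE on weighted-bounded tables. -/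
theorem reading_add_of_bound [Nonempty ι] {wt : ι → ℝ} (hwt : ∀ y, 0 < wt y) {Q Q' : ι → ℝ} {M M' : ℝ}
    (hQ : ∀ y, |Q y| ≤ wt y * M) (hQ' : ∀ y, |Q' y| ≤ wt y * M') :
    reading wt (Q + Q') = reading wt Q + reading wt Q' := by
  have hs : ∀ y, |(Q + Q') y| ≤ wt y * (M + M') := fun y => by
    rw [Pi.add_apply, mul_add]; exact (abs_add_le _ _).trans (add_le_add (hQ y) (hQ' y))
  ext y
  rw [lp.coeFn_add, Pi.add_apply, reading_apply_of_bound hwt hs, reading_apply_of_bound hwt hQ,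
    reading_apply_of_bound hwt hQ', Pi.add_apply, ← Complex.ofReal_add, add_div]

/-- [folklore] The weighted reading of the zero table is `0`. -/
theorem reading_zero_of_pos [Nonempty ι] {wt : ι → ℝ} (hwt : ∀ y, 0 < wt y) : reading wt (0 : ι → ℝ) = 0 := by
  have h0 : ∀ y, |(0 : ι → ℝ) y| ≤ wt y * 0 := fun y => by simp
  ext y
  rw [reading_apply_of_bound hwt h0, Pi.zero_apply, zero_div, Complex.ofReal_zero, lp.coeFn_zero, Pi.zero_apply]

/-- [folklore] `embR κ 0 = 0`. -/
theorem embR_zero (κ : ℝ) : embR κ (0 : Bg → C.Dom → ℝ) = 0 := by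
  have h0 : ∀ (U : Bg) (X : C.Dom), |(0 : Bg → C.Dom → ℝ) U X| ≤ Real.exp (-(κ * C.d X)) * 0 := fun U X => by simp
  ext ⟨U, X⟩
  rw [embR_apply_of_bound h0, Pi.zero_apply, Pi.zero_apply, mul_zero, Complex.ofReal_zero, lp.coeFn_zero, Pi.zero_apply]

/-- [folklore] **A SLICE-SPACE ELEMENT WITH REAL WEIGHTED COORDINATES `e^{κd(X)}·H U X` IS `embR κ H`**, and `H` inherits the
decay-weighted size `‖G‖`. -/
theorem eq_embR_of_coord {κ : ℝ} {G : lp (fun _ : Bg × C.Dom => ℂ) ∞} {H : Bg → C.Dom → ℝ}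
    (h : ∀ (U : Bg) (X : C.Dom), (G : Bg × C.Dom → ℂ) (U, X) = ((Real.exp (κ * C.d X) * H U X : ℝ) : ℂ)) :
    (∀ (U : Bg) (X : C.Dom), |H U X| ≤ Real.exp (-(κ * C.d X)) * ‖G‖) ∧ G = embR κ H := by
  have hb : ∀ (U : Bg) (X : C.Dom), |H U X| ≤ Real.exp (-(κ * C.d X)) * ‖G‖ := by
    intro U X
    have h1 : ‖(G : Bg × C.Dom → ℂ) (U, X)‖ ≤ ‖G‖ := lp.norm_apply_le_norm ENNReal.top_ne_zero G (U, X)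
    rw [h U X, Complex.norm_real, Real.norm_eq_abs, abs_mul, abs_of_pos (Real.exp_pos _)] at h1
    calc |H U X| ≤ ‖G‖ / Real.exp (κ * C.d X) := (le_div_iff₀' (Real.exp_pos _)).mpr h1
      _ = Real.exp (-(κ * C.d X)) * ‖G‖ := by rw [Real.exp_neg, div_eq_mul_inv, mul_comm]
  refine ⟨hb, ?_⟩
  ext ⟨U, X⟩
  rw [h U X, embR_apply_of_bound hb]

/-- [folklore] **THE ORBIT STAYS IN THE INNER BALL** (generic `𝔜`, `Pot`): θ-self-maps of the `r`-ball + a start in the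
closed `θ·r`-ball + `θ·r < r`. -/
theorem norm_emb_le {𝔜 Pot : Type*} [NormedAddCommGroup 𝔜] [NormedSpace ℂ 𝔜] [NormedAddCommGroup Pot] [NormedSpace ℂ Pot]
    {W : Set (ℕ → ℝ)} {Φ : ℕ → ℝ → Pot → 𝔜} {J : ℕ → (𝔜 →L[ℂ] Fut W Pot)} {τ₀ ωh r θ : ℝ} {e₀ : 𝔜 × Fut W Pot}
    (hmaps : ∀ k, ∀ g ∈ W, MapsTo (step W Φ J τ₀ ωh k g) (ball (0 : 𝔜 × Fut W Pot) r) (closedBall 0 (θ * r)))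
    (hθr : θ * r < r) (he₀ : ‖e₀‖ ≤ θ * r) (k : ℕ) {g : ℕ → ℝ} (hg : g ∈ W) : ‖emb W Φ J τ₀ ωh e₀ k g‖ ≤ θ * r := by
  induction k with
  | zero => rw [emb_zero]; exact he₀
  | succ k ih =>
    have h := hmaps k g hg (mem_ball_zero_iff.mpr (lt_of_le_of_lt ih hθr))
    rw [mem_closedBall_zero_iff] at h
    rw [emb_succ]
    exact h

/-! ## §2 The record's injection and the orbit identification -/

section Record

variable [Nonempty ι] {E : Functional C Bg} {W : Set (ℕ → ℝ)} {Adm : Set (Bg → C.Dom → ℝ)}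
  {T : ℕ → (ℕ → ℝ) → (Bg → C.Dom → ℝ) → ι → ℝ} {Ψ : ℕ → ℝ → (ι → ℝ) → Bg → C.Dom → ℝ}
  {κ : ℝ} {wt : ℕ → ι → ℝ} {τ : ℕ → ℕ → ℝ} {τbar ω ωh : ℝ}

/-- [folklore] The sign half of the END of record's weight binder `hτ`. -/
theorem τ_nonneg (hτ : ∀ k j, j ≤ k → 0 ≤ τ k j ∧ τ k j ≤ τbar * ω ^ (k - j)) : ∀ m j, j ≤ m → 0 ≤ τ m j :=
  fun m j h => (hτ m j h).1

/-- [folklore] The geometric half of `hτ`. -/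
theorem τ_geom (hτ : ∀ k j, j ≤ k → 0 ≤ τ k j ∧ τ k j ≤ τbar * ω ^ (k - j)) : ∀ m j, j ≤ m → τ m j ≤ τbar * ω ^ (m - j) :=
  fun m j h => (hτ m j h).2

/-- **THE RECORD's INJECTION `J k`** (route R4 EH2): `injRead` of the ambient readings `RdAmb` (Hahn–Banach-extended complexified
channel readings, `NE9ChannelReadingOfRecord` §6) with `τ₀ := √2·τ̄`; `‖J k‖ ≤ √2·τ̄`. [folklore] -/
def JRec (hadd : ChannelAdditive Adm T) (hres : AdmRestrict Adm) (hstep : ChannelSizeAtStepNN Adm T κ wt τ)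
    (hsub : ∀ H₁ ∈ Adm, ∀ H₂ ∈ Adm, H₁ - H₂ ∈ Adm) (hsmul : ∀ (c : ℝ), ∀ H ∈ Adm, c • H ∈ Adm) (hne : Adm.Nonempty)
    (hwt : ∀ m y, 0 < wt m y) (hτ : ∀ k j, j ≤ k → 0 ≤ τ k j ∧ τ k j ≤ τbar * ω ^ (k - j)) (hτbar : 0 ≤ τbar) (hω : 0 ≤ ω)
    (hωh : 0 < ωh) (hωωh : ω ≤ ωh) (k : ℕ) :
    lp (fun _ : Bg × C.Dom => ℂ) ∞ →L[ℂ] Fut W (lp (fun _ : ι => ℂ) ∞) :=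
  injRead (RdAmb (κ := κ) hadd hres hstep hsub hsmul hne hwt (τ_nonneg hτ)) (τ₀ := Real.sqrt 2 * τbar)
    (mul_nonneg (Real.sqrt_nonneg _) hτbar) hω hωh hωωh (fun j n s _ => norm_RdAmb_le_geometric (τ_geom hτ) j n s) k

omit [Nonempty ι] in
/-- [folklore] `‖JRec k‖ ≤ √2·τ̄`. -/
theorem norm_JRec_le {hadd : ChannelAdditive Adm T} {hres : AdmRestrict Adm} {hstep : ChannelSizeAtStepNN Adm T κ wt τ}
    {hsub : ∀ H₁ ∈ Adm, ∀ H₂ ∈ Adm, H₁ - H₂ ∈ Adm} {hsmul : ∀ (c : ℝ), ∀ H ∈ Adm, c • H ∈ Adm} {hne : Adm.Nonempty}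
    {hwt : ∀ m y, 0 < wt m y} {hτ : ∀ k j, j ≤ k → 0 ≤ τ k j ∧ τ k j ≤ τbar * ω ^ (k - j)} {hτbar : 0 ≤ τbar} {hω : 0 ≤ ω}
    {hωh : 0 < ωh} {hωωh : ω ≤ ωh} (k : ℕ) :
    ‖(JRec hadd hres hstep hsub hsmul hne hwt hτ hτbar hω hωh hωωh k :
      lp (fun _ : Bg × C.Dom => ℂ) ∞ →L[ℂ] Fut W (lp (fun _ : ι => ℂ) ∞))‖ ≤ Real.sqrt 2 * τbar :=
  norm_injRead_le _ _ _ _ _ _ k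

omit [Nonempty ι] in
/-- [folklore] The channel output of a truncated admissible history of slice-size `B₀` is a weighted-bounded table:
`|T m s (truncScale k H) y| ≤ wt m y·(Σ_{j≤m} τ m j·B₀)`. -/
theorem abs_channel_trunc_le (hres : AdmRestrict Adm) (hsum : ChannelStepSum Adm T) (hstep : ChannelSizeAtStepNN Adm T κ wt τ)
    {H : Bg → C.Dom → ℝ} (hH : H ∈ Adm) {k : ℕ} {B₀ : ℝ} (hB₀ : 0 ≤ B₀)
    (hsz : ∀ (U : Bg) (X : C.Dom), C.scale X ≤ k → |H U X| ≤ Real.exp (-(κ * C.d X)) * B₀) (m : ℕ) (s : ℕ → ℝ) (y : ι) :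
    |T m s (truncScale k H) y| ≤ wt m y * ∑ j ∈ Finset.range (m + 1), τ m j * B₀ := by
  refine channelSizeNN_of_perStepNN hres hsum hstep m s (truncScale k H) (hres.2 H hH k) (fun _ => B₀) (fun _ => hB₀)
    (fun U X _ => ?_) y
  by_cases hX : C.scale X ≤ k
  · rw [truncScale, if_pos hX]; exact hsz U X hX
  · rw [truncScale, if_neg hX, abs_zero]; positivity

omit [Nonempty ι] in
/-- [folklore] The same for a one-step slice of size `B₀`: `|T m s (H↾j) y| ≤ wt m y·(Σ_{i≤m} τ m i·B₀)`. -/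
theorem abs_channel_restrict_le (hres : AdmRestrict Adm) (hsum : ChannelStepSum Adm T) (hstep : ChannelSizeAtStepNN Adm T κ wt τ)
    {H : Bg → C.Dom → ℝ} (hH : H ∈ Adm) {j : ℕ} {B₀ : ℝ} (hB₀ : 0 ≤ B₀)
    (hsz : ∀ (U : Bg) (X : C.Dom), C.scale X = j → |H U X| ≤ Real.exp (-(κ * C.d X)) * B₀) (m : ℕ) (s : ℕ → ℝ) (y : ι) :
    |T m s (restrictScale j H) y| ≤ wt m y * ∑ i ∈ Finset.range (m + 1), τ m i * B₀ := by
  refine channelSizeNN_of_perStepNN hres hsum hstep m s (restrictScale j H) (hres.1 H hH j) (fun _ => B₀) (fun _ => hB₀)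
    (fun U X _ => ?_) y
  by_cases hX : C.scale X = j
  · rw [restrictScale_of_eq _ hX]; exact hsz U X hX
  · rw [restrictScale_of_ne _ hX, abs_zero]; positivity

omit [Nonempty ι] in
/-- [folklore] The weighted reading of a weighted-bounded real table, as the element of `lp (ι → ℂ) ∞` with the entries
`Q y ∕ wt y` — uniqueness from the entries. -/
theorem eq_reading_of_apply {wt : ι → ℝ} (hwt : ∀ y, 0 < wt y) {Q : ι → ℝ} {M : ℝ} (hQ : ∀ y, |Q y| ≤ wt y * M)
    {P : lp (fun _ : ι => ℂ) ∞} (hP : ∀ y, (P : ι → ℂ) y = ((Q y / wt y : ℝ) : ℂ)) : P = reading wt Q := by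
  ext y
  rw [hP y, reading_apply_of_bound hwt hQ]

end Record

end Summit.QuantumFields.BalabanUV.T4Continuum.NE9FutureProfileRecordPrelim

end
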